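import Summits.QuantumFields.YangMills.Theorems.BalabanUVNodesN12ForestSliceCurved
import Summits.QuantumFields.YangMills.Theorems.BalabanUVNodesN12DirectSurjHsurjProxiesPrelim
import Summits.QuantumFields.YangMills.Theorems.BalabanUVNodesN12HsurjOfClass
import HarnessLib

/-!
# BalabanUVNodes ∕ N12 — SURJECTIVITY FROM THE FOREST SLICE AT AN UNGUARDED BASE: dag-n12-w3's `N12ForestSliceCurved` §3 with the GLOBAL plaquette guards `t₀` REPLACED by per-row tower
# proxies and — at the record's `𝐁_k(Z)` — by the (2.12) class; the chart-currency (45) letter of [Balaban1985Variational] for EVERY class minimiser, no guard on `U₀`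
# ([Balaban1985Variational] (4) p. 278, (16)–(18) p. 280, (44)–(48) p. 285, (82)–(83) p. 290; [Balaban1985Averaging] (11) p. 19; [Balaban1988Convergent] (2.2), (2.10)–(2.13) pp. 255–257)

Cell `pub-ymgap` (HUMAN RULINGS D-0062 ∕ D-0149), WIDTH SEAT `pub-ymgap-dag-n12-w6` g11 (node N12 = [B15]; key K1⁹ `stmt-QuantumFields-27364`, `--kind proof --supports … --as helper`;
count-neutral).  THEOREMS ONLY (0 `def`, 0 `instance`, 0 `sorry`); by name over dag-n12-w3 g3's `N12ForestSliceCurved` ∕ `N12RootedForest`, NODE 00's `fderiv_msChart_apply_of_hasDerivAt` ∕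
`hasDerivAt_coeField_iter_expChart_smul`, this lineage's `N12DirectSurjHsurjProxiesPrelim` (g7) ∕ `N12HsurjOfClass` (g11, p705019), the lane's ρ5b p677953 ∕ §3b p679665.

WHY (LOCATED-HSURJ row (ii), this seat, bus 2026-08-29 06:49Z).  The (J0′) producer of record at `𝐁_k(Z)` (`N12MinimiserFamilyAtRecordBj.hMin_atRecord_Bj_of_printLetters`) discharges
print's (45) through dag-n12-w3's `exists_forest_preimage_of_surjective_curved`, which asks per base field the GLOBAL plaquette guards `∀ i < k, PlaqSmall t₀ (Ū^i U₀)`,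
`stokesConst·t₀ < δ_N` (used only via `smallBelow_of_plaqSmall` and dag-n10-w1's junction `fderiv_msChart_apply_eq_suProj_qLin`) — unsatisfiable at a (2.12) minimiser pinned on `Γ₀` to
data rough off `Z` (not a gap in print, which reads `U₀` on the constraint towers only).  Here the conclusion is reached with NO guard on `U₀`: each ROW of `DΨ_{𝐁,W,U₀}(0)` is the row at
a guarded PROXY agreeing with `U₀` on the row's sharp tower (component transfer, g7); the orbit tangents `X^ξ_b = Ad(U₀,b⁻¹)ξ(b₋) − ξ(b₊)` of `U₀` and of the proxy agree there; and at the
proxy the tangent is killed by gauge covariance of the averages (dag-n12-w3) read through NODE 00's velocity formula — `SmallBelow` of the PROXY only, no `stokesConst·t₀`.  At the record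
the proxies come from the class (ρ5b ∕ §3b) and the surjectivity on the whole space from `N12HsurjOfClass`.

CONTENTS.  §1 `fderiv_msChart_orbitTangent_apply_eq_zero` (guarded base, chart currency, `SmallBelow` only) · §2 `…_of_sharpProxy` (UNGUARDED base) · §3 ★★★
`exists_forest_preimage_of_surjective_proxies`, `exists_forest_rightInverse_of_surjective_proxies` (general `𝐁`, general datum; level-`0` rows need no proxy) · §4 ★★★
`exists_forest_rightInverse_Bj_of_surjective_proxies` (p678596's `hprox`∕`hproxSite` letters VERBATIM; surjectivity displayed) · §5 ★★★ `exists_forest_rightInverse_Bj_of_isMinimizer_class(_atRecord)`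
(EVERY (2.12)-class minimiser; dag-n12-w3's forest; per-height letters as in `N12HsurjOfClass` — the twin of `exists_forest_rightInverse_Bj_nearFlat_atRecord` without `‖↑U₀ − 1‖ < ρ′`).

HONEST FRAMING.  Bookkeeping by name; per-height EXISTENCE letters (print's volume-uniform (46) NOT claimed); the (45)∕`hR` letter of the LITERATURE producer
`B15Prop1MinimiserFamilyFromThm1AtBaseCentral.…_central` stays in `dIterL` (global-derivative) currency — its re-currencying is plan g91's (r3), which can consume this chart-currency input by
name; nothing of Bałaban's asserted or refuted; N12 NOT discharged; K1⁹ NOT closed; counts unmoved; one finite 𝕋⁴ programme at fixed ε — R4 closes only the conditional rung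
`BalabanLadder.UV`; no summit statement is proved here and NOT the Yang–Mills mass gap (Clay); nothing continuum ∕ ℝ⁴ ∕ OS.
-/

noncomputable section

namespace Summit.QuantumFields.YangMills.BalabanUVNodes.N12ForestSliceOfProxies

open scoped BigOperators Matrix.Norms.L2Operator Topology
open Filter
open Literature.MathematicalPhysics.QuantumFieldTheory.Balaban1983to89
open T4Continuum
open B15DeterminingSets
open BlockAveraging (blockAvg)
open ExpMeanLog (expMeanLogSU deltaSU)
open T4AdjointCovarianceUnitary (lieSU expSU specialUnitaryAd coe_specialUnitaryAd mem_lieSU_iff)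
open Node00
open B16Sect1Backgrounds (toMS iter_gaugeAct)
open B5Eq118OneStroke (iterBlockOf)
open Summit.QuantumFields.YangMills.BalabanUVNodes.N12ForestSliceCurved (exists_twisted_residual_of_forest dIterL_orbitTangent_apply_eq_zero)
open Summit.QuantumFields.YangMills.BalabanUVNodes.N12DirectSurjHsurjProxiesPrelim (fderiv_msChart_apply_eq_of_sharpProxy fderiv_msChart_apply_eq_zero_of_vanish_sharp'
  differentiableAt_msChart_of_towerProxies)

/-! ## §1  Orbit tangents are killed by `DΦ_U(0)` at a guarded base — chart currency, `SmallBelow` only (no plaquette guard `t₀`) -/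

section Guarded

variable {F : T4Family} {N : ℕ} [NeZero N] {K k : ℕ}

/-- ★★ **`DΦ_U(0)` KILLS THE RESIDUAL ORBIT TANGENTS — CHART CURRENCY, `SmallBelow` ONLY.**  At a base field `U` with the (0.4) guards below `k` and NODE 00's chart with its own datum
`M˙U`: for `ξ : T_η → 𝔰𝔲(N)` vanishing at the two centres `embIter j c₋`, `embIter j c₊` of the constrained bond `(j, c)` enumerated `i`, the `i`-th component of `DΦ_U(0)` at the orbit
tangent `X^ξ_b = Ad(U_b⁻¹)ξ(b₋) − ξ(b₊)` vanishes — dag-n12-w3's `dIterL_orbitTangent_apply_eq_zero` (gauge covariance of the averages) read through NODE 00's velocity formula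
`fderiv_msChart_apply_of_hasDerivAt` and `hasDerivAt_coeField_iter_expChart_smul` (no `stokesConst·t₀` plaquette guard).
[cite: Balaban1985Averaging, (11) p.19; Balaban1985Variational, (3)–(4) p.278, Sect. C (44)–(48) p.285, (83) p.290; Balaban1987RG1, (0.21) p.256] -/
theorem fderiv_msChart_orbitTangent_apply_eq_zero (hk : k ≤ (F.P K).m + (F.P K).K) {U : GaugeField (F.P K) 0 (SU N)} (hsb : SmallBelow (avOfRecord F N K) k U)
    (𝔹 : DetSet (F.P K)) (ξ : Site (F.P K) 0 → lieSU (Fin N)) (i : Fin (constrCard 𝔹 k))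
    (hsrc : ξ (embIter ((constrEnum 𝔹 k).symm i).1 ((constrEnum 𝔹 k).symm i).2.1.src) = 0)
    (htgt : ξ (embIter ((constrEnum 𝔹 k).symm i).1 ((constrEnum 𝔹 k).symm i).2.1.tgt) = 0) :
    fderiv ℝ (msChart F N K k 𝔹 (avgFamily (avOfRecord F N K) U) U) 0 (fun b => specialUnitaryAd (U b)⁻¹ (ξ b.src) - ξ b.tgt) i = 0 := by
  set s := (constrEnum 𝔹 k).symm i with hs
  have hj : (s.1 : ℕ) ≤ k := Nat.lt_succ_iff.1 s.1.2
  have hjK : (s.1 : ℕ) ≤ (F.P K).m + (F.P K).K := hj.trans hk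
  have hsbj : SmallBelow (fun i => blockAvg (P := F.P K) (j := i) (expMeanLogSU (n := Fin N))) (s.1 : ℕ) U := hsb.mono hj
  set T : PBond (F.P K) 0 → lieSU (Fin N) := fun b => specialUnitaryAd (U b)⁻¹ (ξ b.src) - ξ b.tgt with hT
  -- the velocity of the level-`j` average along the chart ray `t ↦ U·exp(tT)`
  have hvel := hasDerivAt_coeField_iter_expChart_smul hsbj T
  -- the velocity field `b ↦ U_b·T_b` IS the gauge velocity `ξ(b₋)U_b − U_b ξ(b₊)`
  have hTeq : (fun b : PBond (F.P K) 0 => (U b : Matrix (Fin N) (Fin N) ℂ) * ((T b : lieSU (Fin N)) : Matrix (Fin N) (Fin N) ℂ)) =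
      fun b => (ξ b.src : Matrix (Fin N) (Fin N) ℂ) * (U b : Matrix (Fin N) (Fin N) ℂ) - (U b : Matrix (Fin N) (Fin N) ℂ) * (ξ b.tgt : Matrix (Fin N) (Fin N) ℂ) := by
    funext b
    have hinv : (((U b)⁻¹ : SU N) : Matrix (Fin N) (Fin N) ℂ) = star ((U b : SU N) : Matrix (Fin N) (Fin N) ℂ) := rfl
    rw [hT, Submodule.coe_sub, coe_specialUnitaryAd, hinv, star_star, mul_sub, ← mul_assoc, ← mul_assoc, coe_mul_star_coe_SU, one_mul]
  have hzero : dIterL (s.1 : ℕ) (coeField U) (fun b => (U b : Matrix (Fin N) (Fin N) ℂ) * ((T b : lieSU (Fin N)) : Matrix (Fin N) (Fin N) ℂ)) s.2.1 = 0 := by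
    rw [hTeq]; exact dIterL_orbitTangent_apply_eq_zero hjK hsbj ξ s.2.1 hsrc htgt
  have hvelc : HasDerivAt (fun t : ℝ => ((avgFamily (avOfRecord F N K) (expChart U (t • T)) s.1 s.2.1 : SU N) : Matrix (Fin N) (Fin N) ℂ))
      (0 : Matrix (Fin N) (Fin N) ℂ) 0 := by
    have h := (hasDerivAt_pi.1 hvel) s.2.1
    rw [hzero] at h
    exact h
  rw [fderiv_msChart_apply_of_hasDerivAt (fun _ _ _ => rfl) hsb T i hvelc, mul_zero, map_zero]

end Guarded

/-! ## §2  The same at an UNGUARDED base, from one guarded proxy agreeing with `U₀` on the row's sharp tower -/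

section Proxy

variable {F : T4Family} {N : ℕ} [NeZero N] {K k : ℕ}

/-- `embIter 0 ∘ iterBlockOf 0 = id` (both are the identity at level `0`; stated at a variable level `j = 0` for dependent rewriting). [folklore] -/
theorem embIter_iterBlockOf_of_eq_zero {P : Params} {j : ℕ} (h : j = 0) (x : Site P 0) : embIter j (iterBlockOf j x) = x := by
  subst h; rfl

/-- ★★ **ORBIT TANGENTS ARE KILLED AT AN UNGUARDED BASE `U₀`, GIVEN ONE GUARDED PROXY ON THE ROW's SHARP TOWER.**  `U₀` in the `𝐁`-fibre of a datum `W` with `Ψ_{𝐁,W,U₀}` differentiable at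
`0` (e.g. from one guarded proxy per constrained bond, `differentiableAt_msChart_of_towerProxies`); for the row `i = (j, c)` a proxy `U′` with the (0.4) guards below `k` agreeing with `U₀`
on the sharp tower of `c`; `ξ` vanishing at the two centres of `c`.  Then `(DΨ_{𝐁,W,U₀}(0) X^ξ_{U₀})_i = 0`: the component is the one at the proxy's own chart (this lineage's
`fderiv_msChart_apply_eq_of_sharpProxy`), the tangents `X^ξ_{U₀}` and `X^ξ_{U′}` agree on the sharp tower (so their difference does not move row `i`,
`fderiv_msChart_apply_eq_zero_of_vanish_sharp'`), and §1 applies at `U′`.  NO guard on `U₀`.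
[cite: Balaban1985Averaging, (11) p.19; Balaban1985Variational, (3)–(4) p.278, Sect. C (44)–(48) p.285, (82)–(83) p.290; Balaban1988Convergent, (2.10)–(2.11) p.256; Balaban1987RG1, (0.4) p.253] -/
theorem fderiv_msChart_orbitTangent_apply_eq_zero_of_sharpProxy (hk : k ≤ (F.P K).m + (F.P K).K) {𝔹 : DetSet (F.P K)} {W : MSField (F.P K) (SU N)}
    {U₀ U' : GaugeField (F.P K) 0 (SU N)} (hU : AgreeOn 𝔹 (avgFamily (avOfRecord F N K) U₀) W) (hΨ : DifferentiableAt ℝ (msChart F N K k 𝔹 W U₀) 0)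
    (hsb' : SmallBelow (avOfRecord F N K) k U') (i : Fin (constrCard 𝔹 k))
    (hin : ∀ b₀ : PBond (F.P K) 0,
      (iterBlockOf (((constrEnum 𝔹 k).symm i).1 : ℕ) b₀.src = ((constrEnum 𝔹 k).symm i).2.1.src ∨
        iterBlockOf (((constrEnum 𝔹 k).symm i).1 : ℕ) b₀.src = ((constrEnum 𝔹 k).symm i).2.1.tgt) →
      (iterBlockOf (((constrEnum 𝔹 k).symm i).1 : ℕ) b₀.tgt = ((constrEnum 𝔹 k).symm i).2.1.src ∨
        iterBlockOf (((constrEnum 𝔹 k).symm i).1 : ℕ) b₀.tgt = ((constrEnum 𝔹 k).symm i).2.1.tgt) → U' b₀ = U₀ b₀)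
    (ξ : Site (F.P K) 0 → lieSU (Fin N))
    (hsrc : ξ (embIter ((constrEnum 𝔹 k).symm i).1 ((constrEnum 𝔹 k).symm i).2.1.src) = 0)
    (htgt : ξ (embIter ((constrEnum 𝔹 k).symm i).1 ((constrEnum 𝔹 k).symm i).2.1.tgt) = 0) :
    fderiv ℝ (msChart F N K k 𝔹 W U₀) 0 (fun b => specialUnitaryAd (U₀ b)⁻¹ (ξ b.src) - ξ b.tgt) i = 0 := by
  set T₀ : PBond (F.P K) 0 → lieSU (Fin N) := fun b => specialUnitaryAd (U₀ b)⁻¹ (ξ b.src) - ξ b.tgt with hT₀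
  set T' : PBond (F.P K) 0 → lieSU (Fin N) := fun b => specialUnitaryAd (U' b)⁻¹ (ξ b.src) - ξ b.tgt with hT'
  -- the component at the proxy's own chart
  rw [fderiv_msChart_apply_eq_of_sharpProxy hk hU hΨ hsb' i hin T₀]
  have hΨ' : DifferentiableAt ℝ (msChart F N K k 𝔹 (avgFamily (avOfRecord F N K) U') U') 0 :=
    differentiableAt_msChart (K := K) (k := k) (𝔹 := 𝔹) (W := avgFamily (avOfRecord F N K) U') (U := U') (fun _ _ _ => rfl) hsb'
  -- `T₀ − T'` vanishes on the sharp tower of the row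
  have hvan : fderiv ℝ (msChart F N K k 𝔹 (avgFamily (avOfRecord F N K) U') U') 0 (T₀ - T') i = 0 :=
    fderiv_msChart_apply_eq_zero_of_vanish_sharp' hk hΨ' (T₀ - T') i fun b₀ hs ht => by
      simp only [Pi.sub_apply, hT₀, hT', hin b₀ hs ht, sub_self]
  have heq : fderiv ℝ (msChart F N K k 𝔹 (avgFamily (avOfRecord F N K) U') U') 0 T₀ i =
      fderiv ℝ (msChart F N K k 𝔹 (avgFamily (avOfRecord F N K) U') U') 0 T' i := by
    rw [map_sub, Pi.sub_apply, sub_eq_zero] at hvan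
    exact hvan
  rw [heq]
  exact fderiv_msChart_orbitTangent_apply_eq_zero hk hsb' 𝔹 ξ i hsrc htgt

end Proxy

/-! ## §3  Surjectivity FROM THE FOREST SLICE at an unguarded base, from per-row sharp proxies -/

section Curved

variable {F : T4Family} {N : ℕ} [NeZero N] {K k : ℕ}

/-- ★★★ **SURJECTIVITY FROM THE FOREST SLICE AT AN UNGUARDED BASE** — dag-n12-w3's `N12ForestSliceCurved.exists_forest_preimage_of_surjective_curved` with the global plaquette guards
(`t₀`-small iterated averages below `k`, `stokesConst·t₀ < δ_N`) REPLACED by: differentiability of `Ψ_{𝐁,W,U₀}` at `0` and, for every row of POSITIVE level, one guarded proxy agreeing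
with `U₀` on the row's sharp tower (level-`0` rows need nothing: both end-points are roots, so the orbit tangent vanishes on their sharp tower); general datum `W` with `U₀` in its
`𝐁`-fibre.  If `DΨ_{𝐁,W,U₀}(0)` is onto on the whole space, every target is attained by a field VANISHING ON EVERY PATH BOND of any rooted forest with (F1) whose roots contain `R(𝐁, k)`.
[cite: Balaban1985Variational, (4) p.278, (16)–(18) p.280, (45)–(48) p.285, (82)–(83) p.290; Balaban1985Averaging, (11) p.19; Balaban1985RegularSpaces, (1.19) p.79; Balaban1988Convergent, (2.10)–(2.11) p.256] -/
theorem exists_forest_preimage_of_surjective_proxies (𝔹 : DetSet (F.P K)) (hk : k ≤ (F.P K).m + (F.P K).K)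
    {W : MSField (F.P K) (SU N)} {U₀ : GaugeField (F.P K) 0 (SU N)} (hU : AgreeOn 𝔹 (avgFamily (avOfRecord F N K) U₀) W)
    (hΨ : DifferentiableAt ℝ (msChart F N K k 𝔹 W U₀) 0)
    (hsharp : ∀ i : Fin (constrCard 𝔹 k), 1 ≤ (((constrEnum 𝔹 k).symm i).1 : ℕ) → ∃ U' : GaugeField (F.P K) 0 (SU N),
      SmallBelow (avOfRecord F N K) k U' ∧ ∀ b₀ : PBond (F.P K) 0,
        (iterBlockOf (((constrEnum 𝔹 k).symm i).1 : ℕ) b₀.src = ((constrEnum 𝔹 k).symm i).2.1.src ∨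
          iterBlockOf (((constrEnum 𝔹 k).symm i).1 : ℕ) b₀.src = ((constrEnum 𝔹 k).symm i).2.1.tgt) →
        (iterBlockOf (((constrEnum 𝔹 k).symm i).1 : ℕ) b₀.tgt = ((constrEnum 𝔹 k).symm i).2.1.src ∨
          iterBlockOf (((constrEnum 𝔹 k).symm i).1 : ℕ) b₀.tgt = ((constrEnum 𝔹 k).symm i).2.1.tgt) → U' b₀ = U₀ b₀)
    {path : Site (F.P K) 0 → List (LStep (F.P K) 0)}
    (hroot : ∀ r ∈ {z : Site (F.P K) 0 | ∃ j, j ≤ k ∧ ∃ c ∈ bondsOf (𝔹 j), (z = embIter j c.src ∨ z = embIter j c.tgt)}, path r = [])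
    (hF1 : ∀ x, ∀ s ∈ path x, ∃ x' x'' : Site (F.P K) 0, path x'' = path x' ++ [s] ∧
      (s.fwd = true → s.bond.src = x' ∧ s.bond.tgt = x'') ∧ (s.fwd = false → s.bond.src = x'' ∧ s.bond.tgt = x'))
    (hsurj : Function.Surjective (fderiv ℝ (msChart F N K k 𝔹 W U₀) 0))
    (τ : Fin (constrCard 𝔹 k) → lieSU (Fin N)) :
    ∃ X : PBond (F.P K) 0 → lieSU (Fin N), (∀ x, ∀ s ∈ path x, X s.bond = 0) ∧ fderiv ℝ (msChart F N K k 𝔹 W U₀) 0 X = τ := by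
  obtain ⟨X₀, hX₀⟩ := hsurj τ
  obtain ⟨ξ, hξR, hξ⟩ := exists_twisted_residual_of_forest hroot hF1
    (fun b => (specialUnitaryAd (U₀ b)⁻¹).toLinearEquiv.toAddEquiv) (fun _ => AddEquiv.refl _) X₀
  have hT : fderiv ℝ (msChart F N K k 𝔹 W U₀) 0 (fun b => specialUnitaryAd (U₀ b)⁻¹ (ξ b.src) - ξ b.tgt) = 0 := by
    funext i
    rw [Pi.zero_apply]
    have hj : (((constrEnum 𝔹 k).symm i).1 : ℕ) ≤ k := Nat.le_of_lt_succ ((constrEnum 𝔹 k).symm i).1.isLt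
    have hc : ((constrEnum 𝔹 k).symm i).2.1 ∈ bondsOf (𝔹 ((constrEnum 𝔹 k).symm i).1) := ((constrEnum 𝔹 k).symm i).2.2
    have hsrc : ξ (embIter ((constrEnum 𝔹 k).symm i).1 ((constrEnum 𝔹 k).symm i).2.1.src) = 0 := hξR _ ⟨_, hj, _, hc, Or.inl rfl⟩
    have htgt : ξ (embIter ((constrEnum 𝔹 k).symm i).1 ((constrEnum 𝔹 k).symm i).2.1.tgt) = 0 := hξR _ ⟨_, hj, _, hc, Or.inr rfl⟩
    rcases Nat.eq_zero_or_pos (((constrEnum 𝔹 k).symm i).1 : ℕ) with h0 | hpos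
    · -- level `0`: the tangent vanishes on the sharp tower of the row (both end-points are roots)
      refine fderiv_msChart_apply_eq_zero_of_vanish_sharp' hk hΨ _ i fun b₀ hs ht => ?_
      have hs' : ξ b₀.src = 0 := by
        rw [← embIter_iterBlockOf_of_eq_zero h0 b₀.src]
        rcases hs with h | h
        · rw [h]; exact hsrc
        · rw [h]; exact htgt
      have ht' : ξ b₀.tgt = 0 := by
        rw [← embIter_iterBlockOf_of_eq_zero h0 b₀.tgt]
        rcases ht with h | h
        · rw [h]; exact hsrc
        · rw [h]; exact htgt
      simp only [hs', ht', map_zero, sub_zero]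
    · obtain ⟨U', hsb', hin⟩ := hsharp i hpos
      exact fderiv_msChart_orbitTangent_apply_eq_zero_of_sharpProxy hk hU hΨ hsb' i hin ξ hsrc htgt
  refine ⟨fun b => X₀ b - (specialUnitaryAd (U₀ b)⁻¹ (ξ b.src) - ξ b.tgt), fun x s hs => ?_, ?_⟩
  · have h := hξ x s hs
    show X₀ s.bond - _ = 0
    rw [sub_eq_zero]
    exact h
  · have hsub : (fun b => X₀ b - (specialUnitaryAd (U₀ b)⁻¹ (ξ b.src) - ξ b.tgt)) =
        X₀ - fun b => specialUnitaryAd (U₀ b)⁻¹ (ξ b.src) - ξ b.tgt := rfl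
    rw [hsub, map_sub, hX₀, hT, sub_zero]

/-- ★★ **A LINEAR RIGHT INVERSE OF `DΨ_{𝐁,W,U₀}(0)` VALUED IN THE FOREST SLICE AT AN UNGUARDED BASE** ([Balaban1985Variational] (45) for the tree gauge at the base field itself, chart currency) —
dag-n12-w3's `exists_forest_rightInverse_of_surjective_curved` with the plaquette guards replaced by per-row sharp proxies and differentiability of the chart.
[cite: Balaban1985Variational, (45) p.285, (4) p.278, (16)–(18) p.280; Balaban1985Averaging, (11) p.19; Balaban1985RegularSpaces, (1.19) p.79; Balaban1988Convergent, (2.10)–(2.11) p.256] -/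
theorem exists_forest_rightInverse_of_surjective_proxies (𝔹 : DetSet (F.P K)) (hk : k ≤ (F.P K).m + (F.P K).K)
    {W : MSField (F.P K) (SU N)} {U₀ : GaugeField (F.P K) 0 (SU N)} (hU : AgreeOn 𝔹 (avgFamily (avOfRecord F N K) U₀) W)
    (hΨ : DifferentiableAt ℝ (msChart F N K k 𝔹 W U₀) 0)
    (hsharp : ∀ i : Fin (constrCard 𝔹 k), 1 ≤ (((constrEnum 𝔹 k).symm i).1 : ℕ) → ∃ U' : GaugeField (F.P K) 0 (SU N),
      SmallBelow (avOfRecord F N K) k U' ∧ ∀ b₀ : PBond (F.P K) 0,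
        (iterBlockOf (((constrEnum 𝔹 k).symm i).1 : ℕ) b₀.src = ((constrEnum 𝔹 k).symm i).2.1.src ∨
          iterBlockOf (((constrEnum 𝔹 k).symm i).1 : ℕ) b₀.src = ((constrEnum 𝔹 k).symm i).2.1.tgt) →
        (iterBlockOf (((constrEnum 𝔹 k).symm i).1 : ℕ) b₀.tgt = ((constrEnum 𝔹 k).symm i).2.1.src ∨
          iterBlockOf (((constrEnum 𝔹 k).symm i).1 : ℕ) b₀.tgt = ((constrEnum 𝔹 k).symm i).2.1.tgt) → U' b₀ = U₀ b₀)
    {path : Site (F.P K) 0 → List (LStep (F.P K) 0)}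
    (hroot : ∀ r ∈ {z : Site (F.P K) 0 | ∃ j, j ≤ k ∧ ∃ c ∈ bondsOf (𝔹 j), (z = embIter j c.src ∨ z = embIter j c.tgt)}, path r = [])
    (hF1 : ∀ x, ∀ s ∈ path x, ∃ x' x'' : Site (F.P K) 0, path x'' = path x' ++ [s] ∧
      (s.fwd = true → s.bond.src = x' ∧ s.bond.tgt = x'') ∧ (s.fwd = false → s.bond.src = x'' ∧ s.bond.tgt = x'))
    (hsurj : Function.Surjective (fderiv ℝ (msChart F N K k 𝔹 W U₀) 0)) :
    ∃ H : (Fin (constrCard 𝔹 k) → lieSU (Fin N)) →ₗ[ℝ] (PBond (F.P K) 0 → lieSU (Fin N)),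
      (∀ τ, ∀ x, ∀ s ∈ path x, H τ s.bond = 0) ∧ ∀ τ, fderiv ℝ (msChart F N K k 𝔹 W U₀) 0 (H τ) = τ := by
  let S : Submodule ℝ (PBond (F.P K) 0 → lieSU (Fin N)) :=
    { carrier := {X | ∀ x, ∀ s ∈ path x, X s.bond = 0}
      add_mem' := fun {X Y} hX hY x s hs => by simp only [Pi.add_apply, hX x s hs, hY x s hs, add_zero]
      zero_mem' := fun _ _ _ => rfl
      smul_mem' := fun c X hX x s hs => by simp only [Pi.smul_apply, hX x s hs, smul_zero] }
  set D := fderiv ℝ (msChart F N K k 𝔹 W U₀) 0 with hD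
  have hrange : LinearMap.range ((D : (PBond (F.P K) 0 → lieSU (Fin N)) →ₗ[ℝ] (Fin (constrCard 𝔹 k) → lieSU (Fin N))) ∘ₗ S.subtype) = ⊤ := by
    refine LinearMap.range_eq_top.2 fun τ => ?_
    obtain ⟨X, hXS, hX⟩ := exists_forest_preimage_of_surjective_proxies 𝔹 hk hU hΨ hsharp hroot hF1 hsurj τ
    exact ⟨⟨X, hXS⟩, hX⟩
  obtain ⟨g, hg⟩ := LinearMap.exists_rightInverse_of_surjective _ hrange
  refine ⟨S.subtype ∘ₗ g, fun τ => (g τ).2, fun τ => ?_⟩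
  have h := LinearMap.congr_fun hg τ
  simpa only [LinearMap.comp_apply, LinearMap.id_apply, ContinuousLinearMap.coe_coe] using h

end Curved

/-! ## §4  At the record's `𝐁_k(Z)`: the sharp proxies per row from ONE proxy per inner site (the (P4)′ `hproxSite` shape), differentiability from ONE proxy per constrained bond (`hprox`) -/

section Record

open Literature.MathematicalPhysics.QuantumFieldTheory.Balaban1983to89.B14.Eq213DetSet (Bj maxDomT)
open Literature.MathematicalPhysics.QuantumFieldTheory.Balaban1983to89.B14.Eq213MaximalDomains (side)
open Literature.MathematicalPhysics.QuantumFieldTheory.Balaban1983to89.B14.Eq216Concrete (feeds)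
open Summit.QuantumFields.YangMills.BalabanUVNodes.N12DirectSurjHsurjPrelim (inner_endpoint_of_mem_bondsOf_Bj)

variable {F : T4Family} {N : ℕ} [NeZero N] {K k : ℕ}

/-- ★★★ **A LINEAR RIGHT INVERSE OF `DΨ_{𝐁_k(Z),W,U₀}(0)` VALUED IN THE FOREST SLICE, AT AN UNGUARDED BASE, FROM THE (P4)′ PROXY LETTERS** — dag-n12-w3's
`exists_forest_rightInverse_Bj_of_surjective_curved` with the plaquette guards `t₀` REPLACED by p678596's letters VERBATIM: `hprox` (one guarded proxy per constrained bond, agreeing with `U₀` on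
`feeds c`: differentiability of the chart) and `hproxSite` (one per inner `j`-site, agreeing on the sharp towers of the rows touching it; every positive-level row of `𝐁_k(Z)` has an inner
end-point, `inner_endpoint_of_mem_bondsOf_Bj`).  The surjectivity of `DΨ(0)` on the whole space stays DISPLAYED here (discharged from the class in §5).
[cite: Balaban1985Variational, (45) p.285, (4) p.278, (16)–(18) p.280, (82)–(83) p.290; Balaban1985Averaging, (11) p.19; Balaban1988Convergent, (2.2) p.255, (2.10)–(2.13) pp.256–257] -/
theorem exists_forest_rightInverse_Bj_of_surjective_proxies {M₁ : ℕ} {Z : Set (Site (F.P K) 0)} (hk : k ≤ (F.P K).m + (F.P K).K)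
    {W : MSField (F.P K) (SU N)} {U₀ : GaugeField (F.P K) 0 (SU N)} (hU : AgreeOn (Bj M₁ Z k) (avgFamily (avOfRecord F N K) U₀) W)
    (hprox : ∀ i : Fin (constrCard (Bj M₁ Z k) k), ∃ U' : GaugeField (F.P K) 0 (SU N),
      (∀ b ∈ feeds (((constrEnum (Bj M₁ Z k) k).symm i).1 : ℕ) ((constrEnum (Bj M₁ Z k) k).symm i).2.1, U' b = U₀ b) ∧ SmallBelow (avOfRecord F N K) k U')
    (hproxSite : ∀ (j : ℕ), 1 ≤ j → j ≤ k → ∀ y : Site (F.P K) j, embIter j y ∈ maxDomT M₁ Z j → ∃ U' : GaugeField (F.P K) 0 (SU N),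
      (∀ c : PBond (F.P K) j, (c.src = y ∨ c.tgt = y) → ∀ b₀ : PBond (F.P K) 0,
        (iterBlockOf j b₀.src = c.src ∨ iterBlockOf j b₀.src = c.tgt) → (iterBlockOf j b₀.tgt = c.src ∨ iterBlockOf j b₀.tgt = c.tgt) → U' b₀ = U₀ b₀) ∧
      SmallBelow (avOfRecord F N K) k U')
    {path : Site (F.P K) 0 → List (LStep (F.P K) 0)}
    (hroot : ∀ r ∈ {z : Site (F.P K) 0 | ∃ j, j ≤ k ∧ ∃ c ∈ bondsOf ((Bj M₁ Z k : DetSet (F.P K)) j), (z = embIter j c.src ∨ z = embIter j c.tgt)}, path r = [])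
    (hF1 : ∀ x, ∀ s ∈ path x, ∃ x' x'' : Site (F.P K) 0, path x'' = path x' ++ [s] ∧
      (s.fwd = true → s.bond.src = x' ∧ s.bond.tgt = x'') ∧ (s.fwd = false → s.bond.src = x'' ∧ s.bond.tgt = x'))
    (hsurj : Function.Surjective (fderiv ℝ (msChart F N K k (Bj M₁ Z k) W U₀) 0)) :
    ∃ H : (Fin (constrCard (Bj M₁ Z k : DetSet (F.P K)) k) → lieSU (Fin N)) →ₗ[ℝ] (PBond (F.P K) 0 → lieSU (Fin N)),
      (∀ τ, ∀ x, ∀ s ∈ path x, H τ s.bond = 0) ∧ ∀ τ, fderiv ℝ (msChart F N K k (Bj M₁ Z k) W U₀) 0 (H τ) = τ := by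
  have hΨ : DifferentiableAt ℝ (msChart F N K k (Bj M₁ Z k) W U₀) 0 := differentiableAt_msChart_of_towerProxies hk hU hprox
  refine exists_forest_rightInverse_of_surjective_proxies (Bj M₁ Z k) hk hU hΨ (fun i hpos => ?_) hroot hF1 hsurj
  have hjk : (((constrEnum (Bj M₁ Z k) k).symm i).1 : ℕ) ≤ k := Nat.le_of_lt_succ ((constrEnum (Bj M₁ Z k) k).symm i).1.isLt
  have hc : ((constrEnum (Bj M₁ Z k) k).symm i).2.1 ∈ bondsOf ((Bj M₁ Z k : DetSet (F.P K)) ((constrEnum (Bj M₁ Z k) k).symm i).1) :=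
    ((constrEnum (Bj M₁ Z k) k).symm i).2.2
  rcases inner_endpoint_of_mem_bondsOf_Bj hpos hjk hc with hy | hy
  · obtain ⟨U', hag, hsb'⟩ := hproxSite _ hpos hjk _ hy
    exact ⟨U', hsb', hag _ (Or.inl rfl)⟩
  · obtain ⟨U', hag, hsb'⟩ := hproxSite _ hpos hjk _ hy
    exact ⟨U', hsb', hag _ (Or.inr rfl)⟩

end Record

/-! ## §5  FROM THE CLASS: the chart-currency (45) letter at the record for EVERY (2.12)-class minimiser — no guard on `U₀` -/

section OfClass

open Literature.MathematicalPhysics.QuantumFieldTheory.Balaban1983to89.B14.Eq213DetSet (Bj maxDomT)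
open Literature.MathematicalPhysics.QuantumFieldTheory.Balaban1983to89.B14.Eq213MaximalDomains (side)
open Literature.MathematicalPhysics.QuantumFieldTheory.Balaban1983to89.B14.Eq216Concrete (feeds)
open B15Eq112TorusCover (lift)
open T4AxialGaugeSmallField (boxPlaqs)
open T4CubeChartGnomonic (SU2)
open Summit.QuantumFields.YangMills.BalabanUVNodes.N12TowerProxiesOfClass (towerProxies_Bj_of_mem_class)
open Summit.QuantumFields.YangMills.BalabanUVNodes.N12SiteProxiesOfClass (siteProxies_Bj_of_mem_class)
open Summit.QuantumFields.YangMills.BalabanUVNodes.N12HsurjOfClass (surjective_fderiv_msChart_Bj_of_isMinimizer_class_of_agreeOn)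
open Summit.QuantumFields.YangMills.BalabanUVNodes.N12RootedForest (exists_rootedForest_Bj)
open T4ReflectionCone (three_le_L)

variable {F : T4Family} {k : ℕ}

/-- ★★★ **THE FOREST-SLICE RIGHT INVERSE OF `DΨ_{𝐁_k(Z),W,U₀}(0)` FOR EVERY (2.12)-CLASS MINIMISER — NO GUARD ON `U₀`** ([Balaban1985Variational] (45) for print's comb gauge, chart currency):
`U₀` a minimiser of ANY constrained problem over `regMSCoPOfRecord F 2 ν Kt k (maxDomT ν.M₁ Z)` (only membership is read), `W` any datum with `U₀` in its `𝐁_k(Z)`-fibre, any rooted forest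
with (F1) and roots ⊇ `R(𝐁_k(Z), k)`.  §4 fed by the class (ρ5b ∕ §3b proxies; surjectivity by `N12HsurjOfClass`, p705019); displayed: the per-HEIGHT letters `hsbU` (ρ″), `hHB` (εH, B),
floors `6(d−1)L·εreg ≤ ρ″`, `εreg ≤ εH` (inhabited before `ν` by `N12HsurjOfClass.exists_hsurjLetters`), numerics `k+1 ≤ m+K`, `4L ≤ M₁`, `0 ≤ εreg`, `LᵏM₁ ∣ N₀`.
[cite: Balaban1985Variational, (4) p.278, (16)–(18) p.280, Sect. C (44)–(48) p.285, (82)–(83) p.290; Balaban1985Averaging, (11) p.19; Balaban1985RegularSpaces, (1.19) p.79; Balaban1988Convergent, (2.2) p.255, (2.10)–(2.13) pp.256–257; Balaban1987RG1, (0.4) p.253] -/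
theorem exists_forest_rightInverse_Bj_of_isMinimizer_class (ν : Node00.Stage7Numerics) (Kt : ℕ) (Z : Set (Site (F.P Kt) 0))
    (hkK : k + 1 ≤ (F.P Kt).m + (F.P Kt).K) (hM4 : 4 * (F.P Kt).L ≤ ν.M₁) (hdiv : side (F.P Kt).L ν.M₁ k ∣ (F.P Kt).sitesPerDir 0) (hε : 0 ≤ ν.εreg)
    {ρ'' : ℝ} (hsbU : ∀ V : GaugeField (F.P Kt) 0 SU2, ‖coeField V - 1‖ ≤ ρ'' → SmallBelow (avOfRecord F 2 Kt) k V)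
    (hερ : 6 * ((((F.P Kt).d - 1 : ℕ)) : ℝ) * (F.P Kt).L * ν.εreg ≤ ρ'')
    {εH B : ℝ}
    (hHB : ∀ (Wd : MSField (F.P Kt) SU2) (U₀ : GaugeField (F.P Kt) 0 SU2),
      AgreeOn (Bj ν.M₁ Z k) (avgFamily (avOfRecord F 2 Kt) U₀) Wd →
      (∀ i' : Fin (constrCard (Bj ν.M₁ Z k) k), ∃ U' : GaugeField (F.P Kt) 0 SU2,
        (∀ b ∈ feeds (((constrEnum (Bj ν.M₁ Z k) k).symm i').1 : ℕ) ((constrEnum (Bj ν.M₁ Z k) k).symm i').2.1, U' b = U₀ b) ∧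
          SmallBelow (avOfRecord F 2 Kt) k U') →
      (∀ (j : ℕ), 1 ≤ j → j ≤ k → ∀ y : Site (F.P Kt) j, embIter j y ∈ maxDomT ν.M₁ Z j → ∃ U' : GaugeField (F.P Kt) 0 SU2,
        (∀ c : PBond (F.P Kt) j, (c.src = y ∨ c.tgt = y) → ∀ b₀ : PBond (F.P Kt) 0,
          (iterBlockOf j b₀.src = c.src ∨ iterBlockOf j b₀.src = c.tgt) → (iterBlockOf j b₀.tgt = c.src ∨ iterBlockOf j b₀.tgt = c.tgt) → U' b₀ = U₀ b₀) ∧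
        SmallBelow (avOfRecord F 2 Kt) k U') →
      (∀ (j : ℕ), 1 ≤ j → j ≤ k → ∀ y : Site (F.P Kt) j, embIter j y ∈ maxDomT ν.M₁ Z j →
        PlaqSmallOn (boxPlaqs (fun κ => lift (F.P Kt) (embIter j y) κ - ((((F.P Kt).L ^ j : ℕ) : ℤ) + ((((F.P Kt).L ^ j - 1) / 2 : ℕ) : ℤ)))
          (fun κ => lift (F.P Kt) (embIter j y) κ + ((((F.P Kt).L ^ j : ℕ) : ℤ) + ((((F.P Kt).L ^ j - 1) / 2 : ℕ) : ℤ))) : Set (Plaq (F.P Kt) 0)) εH U₀) →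
      ∃ H : (Fin (constrCard (Bj ν.M₁ Z k) k) → lieSU (Fin 2)) → PBond (F.P Kt) 0 → lieSU (Fin 2),
        (∀ v, fderiv ℝ (msChart F 2 Kt k (Bj ν.M₁ Z k) Wd U₀) 0 (H v) = v) ∧ ∀ v, Real.sqrt (∑ b, ‖H v b‖ ^ 2) ≤ B * ‖v‖)
    (hεH : ν.εreg ≤ εH)
    {𝔹' : DetSet (F.P Kt)} {W' : MSField (F.P Kt) SU2} {U₀ : GaugeField (F.P Kt) 0 SU2}
    (hmin : IsMinimizer (avOfRecord F 2 Kt) (regMSCoPOfRecord F 2 ν Kt k (maxDomT ν.M₁ Z)) 𝔹' W' U₀)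
    {W : MSField (F.P Kt) SU2} (hW : AgreeOn (Bj ν.M₁ Z k) (avgFamily (avOfRecord F 2 Kt) U₀) W)
    {path : Site (F.P Kt) 0 → List (LStep (F.P Kt) 0)}
    (hroot : ∀ r ∈ {z : Site (F.P Kt) 0 | ∃ j, j ≤ k ∧ ∃ c ∈ bondsOf ((Bj ν.M₁ Z k : DetSet (F.P Kt)) j), (z = embIter j c.src ∨ z = embIter j c.tgt)}, path r = [])
    (hF1 : ∀ x, ∀ s ∈ path x, ∃ x' x'' : Site (F.P Kt) 0, path x'' = path x' ++ [s] ∧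
      (s.fwd = true → s.bond.src = x' ∧ s.bond.tgt = x'') ∧ (s.fwd = false → s.bond.src = x'' ∧ s.bond.tgt = x')) :
    ∃ H : (Fin (constrCard (Bj ν.M₁ Z k : DetSet (F.P Kt)) k) → lieSU (Fin 2)) →ₗ[ℝ] (PBond (F.P Kt) 0 → lieSU (Fin 2)),
      (∀ τ, ∀ x, ∀ s ∈ path x, H τ s.bond = 0) ∧ ∀ τ, fderiv ℝ (msChart F 2 Kt k (Bj ν.M₁ Z k) W U₀) 0 (H τ) = τ :=
  exists_forest_rightInverse_Bj_of_surjective_proxies (Nat.le_of_succ_le hkK) hW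
    (towerProxies_Bj_of_mem_class ν Kt Z hkK hM4 hdiv hε hsbU hερ hmin.1)
    (siteProxies_Bj_of_mem_class ν Kt Z hkK hM4 hdiv hε hsbU hερ hmin.1) hroot hF1
    (surjective_fderiv_msChart_Bj_of_isMinimizer_class_of_agreeOn ν Kt Z hkK hM4 hdiv hε hsbU hερ hHB hεH hmin hW)

/-- ★★★ **AT THE RECORD WITH dag-n12-w3's ROOTED FOREST** (`N12RootedForest.exists_rootedForest_Bj`: (F1), (F2), (TREE) at `R(𝐁_k(Z), k)`; `1 ≤ k`): ONE forest `path` for `𝐁_k(Z)` such that at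
EVERY (2.12)-class minimiser `U₀` (any problem over the class; only membership is read) and every datum `W` with `U₀` in its fibre, `DΨ_{𝐁_k(Z),W,U₀}(0)` has a LINEAR right inverse
valued in the forest slice — dag-n12-w3's `exists_forest_rightInverse_Bj_nearFlat_atRecord` with «`‖↑U₀ − 1‖ < ρ′` + plaquette guards» REPLACED by «`U₀` a class minimiser» and the
per-height letters of `N12HsurjOfClass`. [cite: Balaban1985Variational, (45) p.285, (4) p.278, (16)–(18) p.280, (82)–(83) p.290; Balaban1985Averaging, (11) p.19; Balaban1988Convergent, (2.2) p.255, (2.10)–(2.13) pp.256–257] -/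
theorem exists_forest_rightInverse_Bj_of_isMinimizer_class_atRecord (ν : Node00.Stage7Numerics) (Kt : ℕ) (Z : Set (Site (F.P Kt) 0))
    (hkK : k + 1 ≤ (F.P Kt).m + (F.P Kt).K) (hk1 : 1 ≤ k) (hM4 : 4 * (F.P Kt).L ≤ ν.M₁) (hdiv : side (F.P Kt).L ν.M₁ k ∣ (F.P Kt).sitesPerDir 0)
    (hε : 0 ≤ ν.εreg)
    {ρ'' : ℝ} (hsbU : ∀ V : GaugeField (F.P Kt) 0 SU2, ‖coeField V - 1‖ ≤ ρ'' → SmallBelow (avOfRecord F 2 Kt) k V)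
    (hερ : 6 * ((((F.P Kt).d - 1 : ℕ)) : ℝ) * (F.P Kt).L * ν.εreg ≤ ρ'')
    {εH B : ℝ}
    (hHB : ∀ (Wd : MSField (F.P Kt) SU2) (U₀ : GaugeField (F.P Kt) 0 SU2),
      AgreeOn (Bj ν.M₁ Z k) (avgFamily (avOfRecord F 2 Kt) U₀) Wd →
      (∀ i' : Fin (constrCard (Bj ν.M₁ Z k) k), ∃ U' : GaugeField (F.P Kt) 0 SU2,
        (∀ b ∈ feeds (((constrEnum (Bj ν.M₁ Z k) k).symm i').1 : ℕ) ((constrEnum (Bj ν.M₁ Z k) k).symm i').2.1, U' b = U₀ b) ∧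
          SmallBelow (avOfRecord F 2 Kt) k U') →
      (∀ (j : ℕ), 1 ≤ j → j ≤ k → ∀ y : Site (F.P Kt) j, embIter j y ∈ maxDomT ν.M₁ Z j → ∃ U' : GaugeField (F.P Kt) 0 SU2,
        (∀ c : PBond (F.P Kt) j, (c.src = y ∨ c.tgt = y) → ∀ b₀ : PBond (F.P Kt) 0,
          (iterBlockOf j b₀.src = c.src ∨ iterBlockOf j b₀.src = c.tgt) → (iterBlockOf j b₀.tgt = c.src ∨ iterBlockOf j b₀.tgt = c.tgt) → U' b₀ = U₀ b₀) ∧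
        SmallBelow (avOfRecord F 2 Kt) k U') →
      (∀ (j : ℕ), 1 ≤ j → j ≤ k → ∀ y : Site (F.P Kt) j, embIter j y ∈ maxDomT ν.M₁ Z j →
        PlaqSmallOn (boxPlaqs (fun κ => lift (F.P Kt) (embIter j y) κ - ((((F.P Kt).L ^ j : ℕ) : ℤ) + ((((F.P Kt).L ^ j - 1) / 2 : ℕ) : ℤ)))
          (fun κ => lift (F.P Kt) (embIter j y) κ + ((((F.P Kt).L ^ j : ℕ) : ℤ) + ((((F.P Kt).L ^ j - 1) / 2 : ℕ) : ℤ))) : Set (Plaq (F.P Kt) 0)) εH U₀) →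
      ∃ H : (Fin (constrCard (Bj ν.M₁ Z k) k) → lieSU (Fin 2)) → PBond (F.P Kt) 0 → lieSU (Fin 2),
        (∀ v, fderiv ℝ (msChart F 2 Kt k (Bj ν.M₁ Z k) Wd U₀) 0 (H v) = v) ∧ ∀ v, Real.sqrt (∑ b, ‖H v b‖ ^ 2) ≤ B * ‖v‖)
    (hεH : ν.εreg ≤ εH) :
    ∃ path : Site (F.P Kt) 0 → List (LStep (F.P Kt) 0),
      (∀ x, ∀ s ∈ path x, ∃ x' x'' : Site (F.P Kt) 0, path x'' = path x' ++ [s] ∧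
        (s.fwd = true → s.bond.src = x' ∧ s.bond.tgt = x'') ∧ (s.fwd = false → s.bond.src = x'' ∧ s.bond.tgt = x')) ∧
      (∀ j, j ≤ k → ∀ c ∈ bondsOf ((Bj ν.M₁ Z k : DetSet (F.P Kt)) j), path (embIter j c.src) = [] ∧ path (embIter j c.tgt) = []) ∧
      (∀ x : Site (F.P Kt) 0, x ∉ {z : Site (F.P Kt) 0 | ∃ j, j ≤ k ∧ ∃ c ∈ bondsOf ((Bj ν.M₁ Z k : DetSet (F.P Kt)) j), (z = embIter j c.src ∨ z = embIter j c.tgt)} →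
        ∃ (x' : Site (F.P Kt) 0) (s : LStep (F.P Kt) 0), path x = path x' ++ [s] ∧
          (s.fwd = true → s.bond.src = x' ∧ s.bond.tgt = x) ∧ (s.fwd = false → s.bond.src = x ∧ s.bond.tgt = x')) ∧
      ∀ {𝔹' : DetSet (F.P Kt)} {W' : MSField (F.P Kt) SU2} {U₀ : GaugeField (F.P Kt) 0 SU2},
        IsMinimizer (avOfRecord F 2 Kt) (regMSCoPOfRecord F 2 ν Kt k (maxDomT ν.M₁ Z)) 𝔹' W' U₀ →
        ∀ {W : MSField (F.P Kt) SU2}, AgreeOn (Bj ν.M₁ Z k) (avgFamily (avOfRecord F 2 Kt) U₀) W →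
          ∃ H : (Fin (constrCard (Bj ν.M₁ Z k : DetSet (F.P Kt)) k) → lieSU (Fin 2)) →ₗ[ℝ] (PBond (F.P Kt) 0 → lieSU (Fin 2)),
            (∀ τ, ∀ x, ∀ s ∈ path x, H τ s.bond = 0) ∧ ∀ τ, fderiv ℝ (msChart F 2 Kt k (Bj ν.M₁ Z k) W U₀) 0 (H τ) = τ := by
  have hL := three_le_L (F.P Kt)
  have hM1 : 1 ≤ ν.M₁ := by omega
  obtain ⟨path, hF1, hF2, htree⟩ := exists_rootedForest_Bj (P := F.P Kt) (M₁ := ν.M₁) (Z := Z) (Nat.le_of_succ_le hkK) hk1 hM1 hdiv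
  have hroot : ∀ r ∈ {z : Site (F.P Kt) 0 | ∃ j, j ≤ k ∧ ∃ c ∈ bondsOf ((Bj ν.M₁ Z k : DetSet (F.P Kt)) j), (z = embIter j c.src ∨ z = embIter j c.tgt)}, path r = [] := by
    rintro r ⟨j, hj, c, hc, rfl | rfl⟩
    · exact (hF2 j hj c hc).1
    · exact (hF2 j hj c hc).2
  exact ⟨path, hF1, hF2, htree, fun hmin _ hW =>
    exists_forest_rightInverse_Bj_of_isMinimizer_class ν Kt Z hkK hM4 hdiv hε hsbU hερ hHB hεH hmin hW hroot hF1⟩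

end OfClass

end Summit.QuantumFields.YangMills.BalabanUVNodes.N12ForestSliceOfProxies

end
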